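import Literature.MathematicalPhysics.QuantumFieldTheory.Balaban1983to89.B13CoerciveAlongPencil
import Literature.MathematicalPhysics.QuantumFieldTheory.Balaban1983to89.B13DirichletLocalInverseLetters

/-!
# `Balaban1983to89.B13LocalisationRemainderLetters` — T. Bałaban, *Propagators for lattice gauge theories in a background field*, Commun. Math. Phys. **99**
# (1985) 389–434 [Balaban1985BackgroundPropagators], Thm 3.11 p. 416 («R is an operator with small norm … ⟨A, (I − R\*)A⟩ = ⟨A, A⟩ − Re⟨A, RA⟩ ≥
# (1 − O(M^{−1∕2}))⟨A, A⟩ > 0 holding for M sufficiently large»), (3.105) p. 414, (3.87)–(3.89) pp. 409–410 («It is exactly the bound (2.44) of [4]»);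
# [Balaban1984PropagatorsII] (2.44) p. 230, Lemma 2.1 (2.61) p. 234, p. 235: THE SCHUR LETTERS OF THE (3.105)-SHAPED LOCALISATION REMAINDER
# `R = Σ_□ (h_□T_□ − T h_□)·G_□·h_□` — its flat L²-form smallness `⟨A, RA⟩₁ ≤ θ·⟨A, A⟩₁` FROM LETTERS: the partition's slowness `ω` and overlap `n`, the first-moment
# row ∕ column sums `κ` of `T`'s kernel, the row ∕ column sums `g` of the local inverses `G_□`, the weighted defect sums `ε` of `T_□ − T`: `θ = n·g·(2ωκ + ε)`.

statement-level bookkeeping ([folklore] Schur test + overlap counting) with citation tags; kernel-checked; THEOREMS ONLY (0 `def`, 0 instance, 0 notation); nothing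
here is a claim about the Yang–Mills mass gap; nothing of Bałaban's operators is asserted; no node is discharged; count-neutral.

WHY THIS FILE (cell `pub-ymgap`, HUMAN RULING D-0062, Track A node N10 = [Balaban1988RG2Cluster] → N06 row 17; width seat `pub-ymgap-dag-n10-w6` g5; the piece «L6»
LOCATED and NAMED for the width seats by the N10 lane owner dag-n10-c g16, 2026-08-28).  dag-n06-j's typed road for row 17 of the N06 certificate
(`B9Thm311PosViaLocalInversesY.posDefTr_of_local_posDefTr_of_small`, `B9Thm311PosViaLocalFamilyY.posDefTr_of_localFamily_posDefTr_of_small` and their row-17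
faces `deltaAY_parSymY_posDefTr_of_local` ∕ `…_of_localFamily`) reduces Theorem 3.11's clause `PosDefTr 1 (Δ_a(U))` to TWO displayed analytic inputs: (i) `hloc`,
positivity of the compressed local operators (reached on print's class (3.35) through the local-cube road L1–L5 of dag-n10-w3∕w5∕w6 and dag-n06-j's composition),
and (ii) `hsmall`, the L²-form smallness of the (3.105)-shaped remainder `R = Σ_c (M_{h_c}T_c − T M_{h_c})·G_c·M_{h_c}`.  Print settles (ii) in one sentence (the
per-cube bound (3.89) = [4] (2.44), `O(M⁻¹)`, summed with [4] Lemma 2.1 and the finite overlap of the cubes, p. 410 ∕ [4] p. 235); THIS FILE types that sentence in the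
N10 lane's entry-letter currency — product-basis matrices, module 83's Schur bound `B13CoerciveAlongPencil.abs_re_form_le_of_rowSum_colSum` and dictionary
`trIP_one_apply_eq_re_form_toMatrix`, dag-n10-w3's `B13DirichletLocalInverseLetters.toMatrix_cutMulY` — for an ARBITRARY operator `T`, ARBITRARY local operators `T_c`
and ARBITRARY `G_c`, so that it serves both of dag-n06-j's roads (`T_c := T`, `ε = 0`; or `T_c :=` node00-def-Y's Dirichlet cube letters with the defect displayed)
and meets their `hsmall` binder VERBATIM (§2).

WHAT THIS FILE PROVES (all `theorem`s).
§1 (ANY finite index `q`, complex matrices; `D_c = diag(h_c)`, `R = Σ_c (D_cT_c − T D_c)·G_c·D_c`): `localRemainder_apply` (entries `R_{pr} = Σ_c Σ_s (h_c(p)(T_c)_{ps} −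
   T_{ps}h_c(s))·(G_c)_{sr}·h_c(r)`), `norm_localRemainder_apply_le` (pointwise majorant: COMMUTATOR part `|h_c(p) − h_c(s)|·‖T_{ps}‖` + DEFECT part `|h_c(p)|·‖(T_c − T)_{ps}‖`),
   `sum_abs_sub_le_of_overlap` (`Σ_c |h_c(p) − h_c(s)| ≤ 2n·ωδ(p,s)`), `sum_le_card_mul_of_vanish`, ★ `rowSum_localRemainder_le` ∕ ★ `colSum_localRemainder_le` (absolute
   row ∕ column sums `≤ n·g·(2ωκ + ε)` from: `|h_c| ≤ 1`, slowness `|h_c(p) − h_c(s)| ≤ ω·δ(p,s)`, overlap `#{c : h_c(p) ≠ 0} ≤ n`, row ∕ column sums `≤ g` of the `G_c`,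
   δ-FIRST-MOMENT row ∕ column sums `Σ_s ‖T_{ps}‖·δ(p,s) ≤ κ` of `T`, weighted defect sums `|h_c(p)|·Σ_s ‖(T_c − T)_{ps}‖ ≤ ε`, `Σ_p |h_c(p)|·‖(T_c − T)_{ps}‖ ≤ ε`),
   ★★ `abs_re_form_localRemainder_le` (the Schur letter `|Re Σ v̄_i(Rv)_i| ≤ n·g·(2ωκ + ε)·Σ‖v_i‖²`).
§2 (operators on `S → M_N(ℂ)`, flat trace pairing `trIP 1`, matrix-unit product basis): `toMatrix_localRemainder`, ★★★ `trIP_localRemainder_le_of_letters` — EXACTLY the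
   `hsmall` shape `⟨A, (Σ_c (M_{h_c}T_c − T M_{h_c})·G_c·M_{h_c}) A⟩₁ ≤ θ·⟨A, A⟩₁`, `θ := n·g·(2ωκ + ε)`, `δ` any nonnegative gauge of distance on the product index;
   `abs_le_one_of_sum_sq_eq_one` (`Σ_c h_c² = 1 ⟹ |h_c| ≤ 1`).
The torus-letter edition ((3.108)-type decay ⟹ `κ`, `g` by (2.61)), the assembled road (dag-n06-j's §2 ∕ §3 with `hsmall` discharged) and the row-17 face are in the
sibling `B13LocalisationRemainderRoad`.

HONEST FRAMING: count-neutral Literature helper; the LETTERS are DISPLAYED hypotheses — `T`'s kernel first moments (for `Δ_a(U)`: its pencil letters, module 76 ∕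
dag-n10-w2's stations, at the point), the local inverses' row sums (L1 §3 ∕ module 84 on the coercivity ball), the partition's slowness `ω` (= [4] Sect. A's
`|∂h_□| = O(M⁻¹)` read through the location map) and overlap `n` (the tree's `3·9^{d+1}`-type counts), the defect sums `ε` (print: Theorems 3.1–3.2 for the
`D(R_□ − R)D\*`-type terms) — none is proved here; dag-n06-j's LOCALISATION-MISMATCH clause (Dirichlet compressions vs print's `P_□`-localised operators) is inherited
verbatim: `T_c` is a parameter.  Finite-lattice constants, not print's `O(1)`; nothing of [Balaban1985BackgroundPropagators] Thm 3.11 ∕ Cor. 3.6 asserted; N06 ∕ N10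
NOT discharged; K1⁹ NOT closed, no registered stub proved; counts unmoved; one finite 𝕋⁴ programme at fixed ε — R4 closes the conditional finite-𝕋⁴ rung
`BalabanLadder.UV` only; nothing continuum ∕ ℝ⁴ ∕ OS ∕ mass gap ∕ Clay.  0 `sorry`, 0 `def`, standard axioms.  `--supports stmt-QuantumFields-27364` (K1⁹).

References: [Balaban1985BackgroundPropagators] (3.87)–(3.89) pp.409–410, (3.105)–(3.106) p.414, Thm 3.10 (3.107)–(3.108) pp.415–416, Thm 3.11 p.416;
[Balaban1984PropagatorsII] (2.38)–(2.39) p.229, (2.44) p.230, (2.51)–(2.52) p.232, Lemma 2.1 (2.61) p.234, p.235; [Balaban1988RG2Cluster] p.15, (2.16) p.16.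
-/

noncomputable section

namespace Literature.MathematicalPhysics.QuantumFieldTheory.Balaban1983to89.B13LocalisationRemainderLetters

open Finset
open scoped Matrix Matrix.Norms.L2Operator
open Literature.MathematicalPhysics.QuantumFieldTheory.Balaban1983to89
open Literature.MathematicalPhysics.QuantumFieldTheory.Balaban1983to89.B9Thm311ReadingCoords (trIP)
open Literature.MathematicalPhysics.QuantumFieldTheory.Balaban1983to89.B9Thm37CubeCoverCommutators (cutMulY)
open Literature.MathematicalPhysics.QuantumFieldTheory.Balaban1983to89.B13CoerciveAlongPencil
  (abs_re_form_le_of_rowSum_colSum trIP_one_apply_eq_re_form_toMatrix trIP_one_self_eq_sum_norm_sq)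
open Literature.MathematicalPhysics.QuantumFieldTheory.Balaban1983to89.B13DirichletLocalInverseLetters (toMatrix_cutMulY)

/-! ## §1. Schur letters of the (3.105)-shaped remainder: matrices over any finite index -/

section Matrices

variable {q ι : Type} [Fintype q] [DecidableEq q] [Fintype ι]

/-- the entries of the (3.105)-shaped remainder `R = Σ_c (D_c T_c − T D_c)·G_c·D_c`, `D_c = diag(h_c)`:
`R_{pr} = Σ_c Σ_s (h_c(p)·(T_c)_{ps} − T_{ps}·h_c(s))·(G_c)_{sr}·h_c(r)`. [cite: Balaban1985BackgroundPropagators, (3.105) p.414, (3.88) p.409, bookkeeping] -/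
theorem localRemainder_apply (T : Matrix q q ℂ) (Tc G : ι → Matrix q q ℂ) (h : ι → q → ℝ) (p r : q) :
    (∑ c, (Matrix.diagonal (fun s => ((h c s : ℝ) : ℂ)) * Tc c - T * Matrix.diagonal (fun s => ((h c s : ℝ) : ℂ))) * G c *
        Matrix.diagonal (fun s => ((h c s : ℝ) : ℂ))) p r
      = ∑ c, ∑ s, (((h c p : ℝ) : ℂ) * Tc c p s - T p s * ((h c s : ℝ) : ℂ)) * G c s r * ((h c r : ℝ) : ℂ) := by
  rw [Matrix.sum_apply]
  refine Finset.sum_congr rfl fun c _ => ?_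
  rw [Matrix.mul_diagonal, Matrix.mul_apply, Finset.sum_mul]
  refine Finset.sum_congr rfl fun s _ => ?_
  rw [Matrix.sub_apply, Matrix.diagonal_mul, Matrix.mul_diagonal]

/-- the pointwise majorant of the remainder's entries: commutator part `|h_c(p) − h_c(s)|·‖T_{ps}‖` plus defect part `|h_c(p)|·‖(T_c − T)_{ps}‖`, against
`‖(G_c)_{sr}‖·|h_c(r)|`. [cite: Balaban1985BackgroundPropagators, (3.105) p.414, (3.88)–(3.89) p.409, bookkeeping] -/
theorem norm_localRemainder_apply_le (T : Matrix q q ℂ) (Tc G : ι → Matrix q q ℂ) (h : ι → q → ℝ) (p r : q) :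
    ‖(∑ c, (Matrix.diagonal (fun s => ((h c s : ℝ) : ℂ)) * Tc c - T * Matrix.diagonal (fun s => ((h c s : ℝ) : ℂ))) * G c *
        Matrix.diagonal (fun s => ((h c s : ℝ) : ℂ))) p r‖
      ≤ ∑ c, ∑ s, (|h c p - h c s| * ‖T p s‖ + |h c p| * ‖Tc c p s - T p s‖) * ‖G c s r‖ * |h c r| := by
  rw [localRemainder_apply]
  refine (norm_sum_le _ _).trans (Finset.sum_le_sum fun c _ => (norm_sum_le _ _).trans (Finset.sum_le_sum fun s _ => ?_))
  rw [norm_mul, norm_mul, Complex.norm_real, Real.norm_eq_abs]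
  refine mul_le_mul_of_nonneg_right (mul_le_mul_of_nonneg_right ?_ (norm_nonneg _)) (abs_nonneg _)
  have hsplit : ((h c p : ℝ) : ℂ) * Tc c p s - T p s * ((h c s : ℝ) : ℂ)
      = (((h c p : ℝ) : ℂ) - ((h c s : ℝ) : ℂ)) * T p s + ((h c p : ℝ) : ℂ) * (Tc c p s - T p s) := by ring
  rw [hsplit]
  refine (norm_add_le _ _).trans (le_of_eq ?_)
  rw [norm_mul, norm_mul, ← Complex.ofReal_sub, Complex.norm_real, Complex.norm_real, Real.norm_eq_abs, Real.norm_eq_abs]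

omit [Fintype q] [DecidableEq q] in
/-- overlap bookkeeping: if each point meets at most `n` of the cut-offs and `|h_c(p) − h_c(s)| ≤ ω·δ(p,s)` for every `c`, then
`Σ_c |h_c(p) − h_c(s)| ≤ 2·n·(ω·δ(p,s))` (only the `c` with `h_c(p) ≠ 0` or `h_c(s) ≠ 0` contribute).
[cite: Balaban1984PropagatorsII, p.235 (finite overlap of the enlarged cubes); Balaban1985BackgroundPropagators, (3.87) p.409, bookkeeping] -/
theorem sum_abs_sub_le_of_overlap [DecidableEq ι] (h : ι → q → ℝ) (p s : q) {ωδ : ℝ} (hωδ : 0 ≤ ωδ) {n : ℕ}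
    (hlip : ∀ c, |h c p - h c s| ≤ ωδ)
    (hp : (univ.filter fun c => h c p ≠ 0).card ≤ n) (hs : (univ.filter fun c => h c s ≠ 0).card ≤ n) :
    ∑ c, |h c p - h c s| ≤ 2 * n * ωδ := by
  have hsub : (univ.filter fun c => h c p ≠ 0 ∨ h c s ≠ 0) ⊆ (univ : Finset ι) := Finset.filter_subset _ _
  rw [← Finset.sum_subset hsub (fun c _ hc => by
    simp only [Finset.mem_filter, Finset.mem_univ, true_and, not_or, not_not] at hc
    rw [hc.1, hc.2, sub_zero, abs_zero])]
  calc ∑ c ∈ univ.filter (fun c => h c p ≠ 0 ∨ h c s ≠ 0), |h c p - h c s|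
      ≤ ∑ c ∈ univ.filter (fun c => h c p ≠ 0 ∨ h c s ≠ 0), ωδ := Finset.sum_le_sum fun c _ => hlip c
    _ = ((univ.filter fun c => h c p ≠ 0 ∨ h c s ≠ 0).card : ℝ) * ωδ := by rw [Finset.sum_const, nsmul_eq_mul]
    _ ≤ (2 * n) * ωδ := by
        refine mul_le_mul_of_nonneg_right ?_ hωδ
        rw [Finset.filter_or]
        have hcard := Finset.card_union_le (univ.filter fun c => h c p ≠ 0) (univ.filter fun c => h c s ≠ 0)
        have : ((univ.filter fun c => h c p ≠ 0) ∪ (univ.filter fun c => h c s ≠ 0)).card ≤ 2 * n := by omega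
        exact_mod_cast this
    _ = 2 * n * ωδ := by ring

omit [Fintype q] [DecidableEq q] in
/-- support bookkeeping: a family `f c ≤ ε` vanishing at the `c` with `h_c(p) = 0` sums to `≤ n·ε` when at most `n` cut-offs meet `p`.
[cite: Balaban1984PropagatorsII, p.235 (finite overlap); bookkeeping] -/
theorem sum_le_card_mul_of_vanish [DecidableEq ι] (h : ι → q → ℝ) (p : q) (f : ι → ℝ) {ε : ℝ} (hε : 0 ≤ ε) {n : ℕ}
    (hf : ∀ c, f c ≤ ε) (hf0 : ∀ c, h c p = 0 → f c = 0) (hp : (univ.filter fun c => h c p ≠ 0).card ≤ n) :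
    ∑ c, f c ≤ n * ε := by
  have hsub : (univ.filter fun c => h c p ≠ 0) ⊆ (univ : Finset ι) := Finset.filter_subset _ _
  rw [← Finset.sum_subset hsub (fun c _ hc => by
    simp only [Finset.mem_filter, Finset.mem_univ, true_and, not_not] at hc
    exact hf0 c hc)]
  calc ∑ c ∈ univ.filter (fun c => h c p ≠ 0), f c
      ≤ ∑ c ∈ univ.filter (fun c => h c p ≠ 0), ε := Finset.sum_le_sum fun c _ => hf c
    _ = ((univ.filter fun c => h c p ≠ 0).card : ℝ) * ε := by rw [Finset.sum_const, nsmul_eq_mul]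
    _ ≤ n * ε := mul_le_mul_of_nonneg_right (by exact_mod_cast hp) hε

/-- ★ **ROW SUMS OF THE REMAINDER**: with `|h_c| ≤ 1`, slowness `|h_c(p) − h_c(s)| ≤ ω·δ(p,s)`, overlap `≤ n`, row sums `≤ g` of the `G_c`, the δ-FIRST-MOMENT row
sums `Σ_s ‖T_{ps}‖·δ(p,s) ≤ κ` of `T` and the weighted defect row sums `|h_c(p)|·Σ_s ‖(T_c − T)_{ps}‖ ≤ ε`: every absolute row sum of `R` is `≤ n·g·(2ωκ + ε)`.
[cite: Balaban1985BackgroundPropagators, (3.105) p.414, (3.89) p.409 («O(M⁻¹)»), p.410; Balaban1984PropagatorsII, (2.44) p.230, Lemma 2.1 (2.61) p.234, p.235] -/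
theorem rowSum_localRemainder_le [DecidableEq ι] (T : Matrix q q ℂ) (Tc G : ι → Matrix q q ℂ) (h : ι → q → ℝ) (δ : q → q → ℝ)
    {ω κ g ε : ℝ} {n : ℕ} (hω : 0 ≤ ω) (hδ : ∀ p s, 0 ≤ δ p s) (hg : 0 ≤ g) (hε : 0 ≤ ε)
    (hh1 : ∀ c s, |h c s| ≤ 1) (hlip : ∀ c p s, |h c p - h c s| ≤ ω * δ p s)
    (hov : ∀ p, (univ.filter fun c => h c p ≠ 0).card ≤ n)
    (hGrow : ∀ c s, ∑ r, ‖G c s r‖ ≤ g) (hTrow : ∀ p, ∑ s, ‖T p s‖ * δ p s ≤ κ)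
    (hErow : ∀ c p, |h c p| * ∑ s, ‖Tc c p s - T p s‖ ≤ ε) (p : q) :
    ∑ r, ‖(∑ c, (Matrix.diagonal (fun s => ((h c s : ℝ) : ℂ)) * Tc c - T * Matrix.diagonal (fun s => ((h c s : ℝ) : ℂ))) * G c *
        Matrix.diagonal (fun s => ((h c s : ℝ) : ℂ))) p r‖ ≤ n * g * (2 * ω * κ + ε) := by
  have hκ : 0 ≤ κ := (Finset.sum_nonneg fun s _ => mul_nonneg (norm_nonneg _) (hδ p s)).trans (hTrow p)
  -- Step A: the pointwise majorant with `|h_c(r)| ≤ 1` dropped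
  have hA : ∀ r, ‖(∑ c, (Matrix.diagonal (fun s => ((h c s : ℝ) : ℂ)) * Tc c - T * Matrix.diagonal (fun s => ((h c s : ℝ) : ℂ))) * G c *
        Matrix.diagonal (fun s => ((h c s : ℝ) : ℂ))) p r‖
      ≤ ∑ c, ∑ s, (|h c p - h c s| * ‖T p s‖ + |h c p| * ‖Tc c p s - T p s‖) * ‖G c s r‖ := by
    intro r
    refine (norm_localRemainder_apply_le T Tc G h p r).trans (Finset.sum_le_sum fun c _ => Finset.sum_le_sum fun s _ => ?_)
    have h0 : 0 ≤ (|h c p - h c s| * ‖T p s‖ + |h c p| * ‖Tc c p s - T p s‖) * ‖G c s r‖ := by positivity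
    calc _ ≤ (|h c p - h c s| * ‖T p s‖ + |h c p| * ‖Tc c p s - T p s‖) * ‖G c s r‖ * 1 :=
          mul_le_mul_of_nonneg_left (hh1 c r) h0
      _ = _ := mul_one _
  -- Step B: exchange the sums and use the row sums of the `G_c`
  have hB : ∑ r, ∑ c, ∑ s, (|h c p - h c s| * ‖T p s‖ + |h c p| * ‖Tc c p s - T p s‖) * ‖G c s r‖
      ≤ g * ∑ c, ∑ s, (|h c p - h c s| * ‖T p s‖ + |h c p| * ‖Tc c p s - T p s‖) := by
    rw [Finset.sum_comm, Finset.mul_sum]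
    refine Finset.sum_le_sum fun c _ => ?_
    rw [Finset.sum_comm, Finset.mul_sum]
    refine Finset.sum_le_sum fun s _ => ?_
    rw [← Finset.mul_sum, mul_comm g]
    exact mul_le_mul_of_nonneg_left (hGrow c s) (by positivity)
  -- Step C: the commutator part
  have hC : ∑ c, ∑ s, |h c p - h c s| * ‖T p s‖ ≤ 2 * n * ω * κ := by
    rw [Finset.sum_comm]
    calc ∑ s, ∑ c, |h c p - h c s| * ‖T p s‖ = ∑ s, (∑ c, |h c p - h c s|) * ‖T p s‖ := by
          refine Finset.sum_congr rfl fun s _ => ?_; rw [Finset.sum_mul]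
      _ ≤ ∑ s, (2 * n * (ω * δ p s)) * ‖T p s‖ := Finset.sum_le_sum fun s _ =>
          mul_le_mul_of_nonneg_right (sum_abs_sub_le_of_overlap h p s (mul_nonneg hω (hδ p s)) (fun c => hlip c p s) (hov p) (hov s))
            (norm_nonneg _)
      _ = 2 * n * ω * ∑ s, ‖T p s‖ * δ p s := by rw [Finset.mul_sum]; refine Finset.sum_congr rfl fun s _ => ?_; ring
      _ ≤ 2 * n * ω * κ := mul_le_mul_of_nonneg_left (hTrow p) (by positivity)
  -- Step D: the defect part
  have hD : ∑ c, ∑ s, |h c p| * ‖Tc c p s - T p s‖ ≤ n * ε := by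
    refine sum_le_card_mul_of_vanish h p (fun c => ∑ s, |h c p| * ‖Tc c p s - T p s‖) hε (fun c => ?_) (fun c hc => ?_) (hov p)
    · rw [← Finset.mul_sum]; exact hErow c p
    · simp [hc]
  calc _ ≤ ∑ r, ∑ c, ∑ s, (|h c p - h c s| * ‖T p s‖ + |h c p| * ‖Tc c p s - T p s‖) * ‖G c s r‖ := Finset.sum_le_sum fun r _ => hA r
    _ ≤ g * ∑ c, ∑ s, (|h c p - h c s| * ‖T p s‖ + |h c p| * ‖Tc c p s - T p s‖) := hB
    _ = g * (∑ c, ∑ s, |h c p - h c s| * ‖T p s‖ + ∑ c, ∑ s, |h c p| * ‖Tc c p s - T p s‖) := by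
        congr 1; rw [← Finset.sum_add_distrib]; refine Finset.sum_congr rfl fun c _ => ?_; rw [← Finset.sum_add_distrib]
    _ ≤ g * (2 * n * ω * κ + n * ε) := mul_le_mul_of_nonneg_left (add_le_add hC hD) hg
    _ = n * g * (2 * ω * κ + ε) := by ring

/-- ★ **COLUMN SUMS OF THE REMAINDER**: with `|h_c| ≤ 1`, slowness, overlap `≤ n`, column sums `≤ g` of the `G_c`, the δ-first-moment COLUMN sums
`Σ_p ‖T_{ps}‖·δ(p,s) ≤ κ` of `T` and the weighted defect column sums `Σ_p |h_c(p)|·‖(T_c − T)_{ps}‖ ≤ ε`: every absolute column sum of `R` is `≤ n·g·(2ωκ + ε)`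
(in fact `≤ n·g·(ωκ + ε)`). [cite: Balaban1985BackgroundPropagators, (3.105) p.414, (3.89) p.409, p.410; Balaban1984PropagatorsII, (2.52) p.232, Lemma 2.1 (2.61) p.234, p.235] -/
theorem colSum_localRemainder_le [DecidableEq ι] (T : Matrix q q ℂ) (Tc G : ι → Matrix q q ℂ) (h : ι → q → ℝ) (δ : q → q → ℝ)
    {ω κ g ε : ℝ} {n : ℕ} (hω : 0 ≤ ω) (hδ : ∀ p s, 0 ≤ δ p s) (hg : 0 ≤ g) (hε : 0 ≤ ε)
    (hh1 : ∀ c s, |h c s| ≤ 1) (hlip : ∀ c p s, |h c p - h c s| ≤ ω * δ p s)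
    (hov : ∀ p, (univ.filter fun c => h c p ≠ 0).card ≤ n)
    (hGcol : ∀ c r, ∑ s, ‖G c s r‖ ≤ g) (hTcol : ∀ s, ∑ p, ‖T p s‖ * δ p s ≤ κ)
    (hEcol : ∀ c s, ∑ p, |h c p| * ‖Tc c p s - T p s‖ ≤ ε) (r : q) :
    ∑ p, ‖(∑ c, (Matrix.diagonal (fun s => ((h c s : ℝ) : ℂ)) * Tc c - T * Matrix.diagonal (fun s => ((h c s : ℝ) : ℂ))) * G c *
        Matrix.diagonal (fun s => ((h c s : ℝ) : ℂ))) p r‖ ≤ n * g * (2 * ω * κ + ε) := by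
  rcases isEmpty_or_nonempty q with hq | ⟨⟨s₀⟩⟩
  · exact (IsEmpty.false r).elim
  have hκ : 0 ≤ κ := (Finset.sum_nonneg fun p _ => mul_nonneg (norm_nonneg _) (hδ p s₀)).trans (hTcol s₀)
  -- Step A: pointwise majorant, sums exchanged: `Σ_p Σ_c Σ_s → Σ_c Σ_s Σ_p`
  have hA : ∑ p, ‖(∑ c, (Matrix.diagonal (fun s => ((h c s : ℝ) : ℂ)) * Tc c - T * Matrix.diagonal (fun s => ((h c s : ℝ) : ℂ))) * G c *
        Matrix.diagonal (fun s => ((h c s : ℝ) : ℂ))) p r‖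
      ≤ ∑ c, ∑ s, (∑ p, (|h c p - h c s| * ‖T p s‖ + |h c p| * ‖Tc c p s - T p s‖)) * ‖G c s r‖ * |h c r| := by
    calc _ ≤ ∑ p, ∑ c, ∑ s, (|h c p - h c s| * ‖T p s‖ + |h c p| * ‖Tc c p s - T p s‖) * ‖G c s r‖ * |h c r| :=
          Finset.sum_le_sum fun p _ => norm_localRemainder_apply_le T Tc G h p r
      _ = _ := by
          rw [Finset.sum_comm]
          refine Finset.sum_congr rfl fun c _ => ?_
          rw [Finset.sum_comm]
          refine Finset.sum_congr rfl fun s _ => ?_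
          rw [Finset.sum_mul, Finset.sum_mul]
  -- Step B: the inner `p`-sums: commutator part `≤ ωκ`, defect part `≤ ε`
  have hB : ∀ c s, ∑ p, (|h c p - h c s| * ‖T p s‖ + |h c p| * ‖Tc c p s - T p s‖) ≤ ω * κ + ε := by
    intro c s
    rw [Finset.sum_add_distrib]
    refine add_le_add ?_ (hEcol c s)
    calc ∑ p, |h c p - h c s| * ‖T p s‖ ≤ ∑ p, ω * δ p s * ‖T p s‖ :=
          Finset.sum_le_sum fun p _ => mul_le_mul_of_nonneg_right (hlip c p s) (norm_nonneg _)
      _ = ω * ∑ p, ‖T p s‖ * δ p s := by rw [Finset.mul_sum]; refine Finset.sum_congr rfl fun p _ => ?_; ring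
      _ ≤ ω * κ := mul_le_mul_of_nonneg_left (hTcol s) hω
  -- Step C: per cut-off, `≤ |h_c(r)|·g·(ωκ + ε)`; then the overlap count
  have hC : ∀ c, ∑ s, (∑ p, (|h c p - h c s| * ‖T p s‖ + |h c p| * ‖Tc c p s - T p s‖)) * ‖G c s r‖ * |h c r|
      ≤ |h c r| * (g * (ω * κ + ε)) := by
    intro c
    calc _ ≤ ∑ s, (ω * κ + ε) * ‖G c s r‖ * |h c r| := Finset.sum_le_sum fun s _ =>
          mul_le_mul_of_nonneg_right (mul_le_mul_of_nonneg_right (hB c s) (norm_nonneg _)) (abs_nonneg _)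
      _ = |h c r| * ((ω * κ + ε) * ∑ s, ‖G c s r‖) := by rw [Finset.mul_sum, Finset.mul_sum]; refine Finset.sum_congr rfl fun s _ => ?_; ring
      _ ≤ |h c r| * ((ω * κ + ε) * g) := mul_le_mul_of_nonneg_left (mul_le_mul_of_nonneg_left (hGcol c r) (by positivity)) (abs_nonneg _)
      _ = |h c r| * (g * (ω * κ + ε)) := by ring
  calc _ ≤ ∑ c, ∑ s, (∑ p, (|h c p - h c s| * ‖T p s‖ + |h c p| * ‖Tc c p s - T p s‖)) * ‖G c s r‖ * |h c r| := hA
    _ ≤ ∑ c, |h c r| * (g * (ω * κ + ε)) := Finset.sum_le_sum fun c _ => hC c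
    _ ≤ n * (g * (ω * κ + ε)) := by
        refine sum_le_card_mul_of_vanish h r (fun c => |h c r| * (g * (ω * κ + ε))) (by positivity) (fun c => ?_) (fun c hc => ?_) (hov r)
        · calc |h c r| * (g * (ω * κ + ε)) ≤ 1 * (g * (ω * κ + ε)) := mul_le_mul_of_nonneg_right (hh1 c r) (by positivity)
            _ = _ := one_mul _
        · rw [hc, abs_zero, zero_mul]
    _ ≤ n * g * (2 * ω * κ + ε) := by
        have : (n : ℝ) * (g * (ω * κ)) ≥ 0 := by positivity
        nlinarith

/-- ★★ **THE SCHUR LETTER OF THE (3.105)-SHAPED REMAINDER**: under the row AND column hypotheses above, `|Re Σ_i v̄_i (R v)_i| ≤ n·g·(2ωκ + ε)·Σ_i ‖v_i‖²`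
(module 83 §1 `abs_re_form_le_of_rowSum_colSum`). [cite: Balaban1985BackgroundPropagators, Thm 3.11 proof p.416 («R is an operator with small norm»), (3.105) p.414,
(3.89) p.409; Balaban1984PropagatorsII, Lemma 2.1 (2.61) p.234; Balaban1988RG2Cluster, p.15, (2.16) p.16] -/
theorem abs_re_form_localRemainder_le [DecidableEq ι] (T : Matrix q q ℂ) (Tc G : ι → Matrix q q ℂ) (h : ι → q → ℝ) (δ : q → q → ℝ)
    {ω κ g ε : ℝ} {n : ℕ} (hω : 0 ≤ ω) (hδ : ∀ p s, 0 ≤ δ p s) (hg : 0 ≤ g) (hε : 0 ≤ ε)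
    (hh1 : ∀ c s, |h c s| ≤ 1) (hlip : ∀ c p s, |h c p - h c s| ≤ ω * δ p s)
    (hov : ∀ p, (univ.filter fun c => h c p ≠ 0).card ≤ n)
    (hGrow : ∀ c s, ∑ r, ‖G c s r‖ ≤ g) (hGcol : ∀ c r, ∑ s, ‖G c s r‖ ≤ g)
    (hTrow : ∀ p, ∑ s, ‖T p s‖ * δ p s ≤ κ) (hTcol : ∀ s, ∑ p, ‖T p s‖ * δ p s ≤ κ)
    (hErow : ∀ c p, |h c p| * ∑ s, ‖Tc c p s - T p s‖ ≤ ε) (hEcol : ∀ c s, ∑ p, |h c p| * ‖Tc c p s - T p s‖ ≤ ε) (v : q → ℂ) :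
    |(∑ i, star (v i) * ((∑ c, (Matrix.diagonal (fun s => ((h c s : ℝ) : ℂ)) * Tc c - T * Matrix.diagonal (fun s => ((h c s : ℝ) : ℂ))) * G c *
        Matrix.diagonal (fun s => ((h c s : ℝ) : ℂ))) *ᵥ v) i).re| ≤ n * g * (2 * ω * κ + ε) * ∑ i, ‖v i‖ ^ 2 := by
  rcases isEmpty_or_nonempty q with hq | ⟨⟨s₀⟩⟩
  · simp [Finset.univ_eq_empty]
  have hκ : 0 ≤ κ := (Finset.sum_nonneg fun s _ => mul_nonneg (norm_nonneg _) (hδ s₀ s)).trans (hTrow s₀)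
  exact abs_re_form_le_of_rowSum_colSum _ (by positivity)
    (rowSum_localRemainder_le T Tc G h δ hω hδ hg hε hh1 hlip hov hGrow hTrow hErow)
    (colSum_localRemainder_le T Tc G h δ hω hδ hg hε hh1 hlip hov hGcol hTcol hEcol) v

end Matrices

/-! ## §2. Operators on `S → M_N(ℂ)`: the remainder's form bound in the matrix-unit product basis (EXACTLY the `hsmall` shape) -/

section Operators

variable {S : Type} [Fintype S] [DecidableEq S] {N : ℕ} {ι : Type} [Fintype ι] [DecidableEq ι]

omit [DecidableEq ι] in
/-- the product-basis matrix of the (3.105)-shaped remainder `Σ_c (M_{h_c}T_c − T M_{h_c})·G_c·M_{h_c}` is the §1 matrix expression over the product-basis matrices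
(w3's `toMatrix_cutMulY`: `M_h ↦ diag(h ∘ fst)`). [cite: Balaban1985BackgroundPropagators, (3.105) p.414, (3.87)–(3.88) p.409, dictionary] -/
theorem toMatrix_localRemainder (T : Module.End ℂ (S → Matrix (Fin N) (Fin N) ℂ)) (Tloc Gop : ι → Module.End ℂ (S → Matrix (Fin N) (Fin N) ℂ))
    (hf : ι → S → ℝ) :
    LinearMap.toMatrix ((Pi.basis fun _ : S => Matrix.stdBasis ℂ (Fin N) (Fin N)).reindex (Equiv.sigmaEquivProd (S) (Fin N × Fin N)))
        ((Pi.basis fun _ : S => Matrix.stdBasis ℂ (Fin N) (Fin N)).reindex (Equiv.sigmaEquivProd (S) (Fin N × Fin N))) (∑ c, (cutMulY (hf c) * Tloc c - T * cutMulY (hf c)) * Gop c * cutMulY (hf c))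
      = ∑ c, (Matrix.diagonal (fun s : S × (Fin N × Fin N) => ((hf c s.1 : ℝ) : ℂ)) *
            LinearMap.toMatrix ((Pi.basis fun _ : S => Matrix.stdBasis ℂ (Fin N) (Fin N)).reindex (Equiv.sigmaEquivProd (S) (Fin N × Fin N)))
        ((Pi.basis fun _ : S => Matrix.stdBasis ℂ (Fin N) (Fin N)).reindex (Equiv.sigmaEquivProd (S) (Fin N × Fin N))) (Tloc c)
          - LinearMap.toMatrix ((Pi.basis fun _ : S => Matrix.stdBasis ℂ (Fin N) (Fin N)).reindex (Equiv.sigmaEquivProd (S) (Fin N × Fin N)))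
        ((Pi.basis fun _ : S => Matrix.stdBasis ℂ (Fin N) (Fin N)).reindex (Equiv.sigmaEquivProd (S) (Fin N × Fin N))) T * Matrix.diagonal (fun s : S × (Fin N × Fin N) => ((hf c s.1 : ℝ) : ℂ))) *
          LinearMap.toMatrix ((Pi.basis fun _ : S => Matrix.stdBasis ℂ (Fin N) (Fin N)).reindex (Equiv.sigmaEquivProd (S) (Fin N × Fin N)))
        ((Pi.basis fun _ : S => Matrix.stdBasis ℂ (Fin N) (Fin N)).reindex (Equiv.sigmaEquivProd (S) (Fin N × Fin N))) (Gop c) *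
        Matrix.diagonal (fun s : S × (Fin N × Fin N) => ((hf c s.1 : ℝ) : ℂ)) := by
  rw [map_sum]
  refine Finset.sum_congr rfl fun c _ => ?_
  rw [LinearMap.toMatrix_mul, LinearMap.toMatrix_mul, map_sub, LinearMap.toMatrix_mul, LinearMap.toMatrix_mul, toMatrix_cutMulY]

/-- ★★ **THE (3.105) REMAINDER IS FORM-SMALL BY ITS LETTERS** — EXACTLY the `hsmall` binder of n06-j's `posDefTr_of_localFamily_posDefTr_of_small` ∕
`deltaAY_parSymY_posDefTr_of_localFamily` (and, with `T_c := T`, `ε := 0`, of `posDefTr_of_local_posDefTr_of_small`), with `θ := n·g·(2ωκ + ε)`: for ANY operator `T`,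
ANY local family `T_c`, ANY family `G_c` (in particular the local inverses `dirInvY (M_{χ_c}) T_c`) and real cut-offs `h_c` with `|h_c| ≤ 1`, slowness
`|h_c(x) − h_c(y)| ≤ ω·δ` (`δ ≥ 0` any gauge of distance on the product index), overlap `#{c : h_c(x) ≠ 0} ≤ n`, row ∕ column sums `≤ g` of the `G_c`'s product-basis
matrices, δ-first-moment row ∕ column sums `≤ κ` of `T`'s, and `|h_c|`-weighted defect row ∕ column sums `≤ ε` of `(T_c − T)`'s:
`⟨A, R A⟩₁ ≤ n·g·(2ωκ + ε)·⟨A, A⟩₁`. [cite: Balaban1985BackgroundPropagators, Thm 3.11 proof p.416 («R is an operator with small norm … (1 − O(M^{−1∕2}))⟨A,A⟩»),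
(3.105) p.414, (3.89) p.409, p.410; Balaban1984PropagatorsII, (2.44) p.230, Lemma 2.1 (2.61) p.234; Balaban1988RG2Cluster, p.15, (2.16) p.16] -/
theorem trIP_localRemainder_le_of_letters (T : Module.End ℂ (S → Matrix (Fin N) (Fin N) ℂ))
    (Tloc Gop : ι → Module.End ℂ (S → Matrix (Fin N) (Fin N) ℂ)) (hf : ι → S → ℝ)
    (δ : S × (Fin N × Fin N) → S × (Fin N × Fin N) → ℝ) {ω κ g ε : ℝ} {n : ℕ}
    (hω : 0 ≤ ω) (hδ : ∀ p s, 0 ≤ δ p s) (hg : 0 ≤ g) (hε : 0 ≤ ε)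
    (hh1 : ∀ c x, |hf c x| ≤ 1) (hlip : ∀ c p s, |hf c p.1 - hf c s.1| ≤ ω * δ p s)
    (hov : ∀ x : S, (univ.filter fun c => hf c x ≠ 0).card ≤ n)
    (hGrow : ∀ c s, ∑ r, ‖LinearMap.toMatrix ((Pi.basis fun _ : S => Matrix.stdBasis ℂ (Fin N) (Fin N)).reindex (Equiv.sigmaEquivProd (S) (Fin N × Fin N)))
        ((Pi.basis fun _ : S => Matrix.stdBasis ℂ (Fin N) (Fin N)).reindex (Equiv.sigmaEquivProd (S) (Fin N × Fin N))) (Gop c) s r‖ ≤ g)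
    (hGcol : ∀ c r, ∑ s, ‖LinearMap.toMatrix ((Pi.basis fun _ : S => Matrix.stdBasis ℂ (Fin N) (Fin N)).reindex (Equiv.sigmaEquivProd (S) (Fin N × Fin N)))
        ((Pi.basis fun _ : S => Matrix.stdBasis ℂ (Fin N) (Fin N)).reindex (Equiv.sigmaEquivProd (S) (Fin N × Fin N))) (Gop c) s r‖ ≤ g)
    (hTrow : ∀ p, ∑ s, ‖LinearMap.toMatrix ((Pi.basis fun _ : S => Matrix.stdBasis ℂ (Fin N) (Fin N)).reindex (Equiv.sigmaEquivProd (S) (Fin N × Fin N)))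
        ((Pi.basis fun _ : S => Matrix.stdBasis ℂ (Fin N) (Fin N)).reindex (Equiv.sigmaEquivProd (S) (Fin N × Fin N))) T p s‖ * δ p s ≤ κ)
    (hTcol : ∀ s, ∑ p, ‖LinearMap.toMatrix ((Pi.basis fun _ : S => Matrix.stdBasis ℂ (Fin N) (Fin N)).reindex (Equiv.sigmaEquivProd (S) (Fin N × Fin N)))
        ((Pi.basis fun _ : S => Matrix.stdBasis ℂ (Fin N) (Fin N)).reindex (Equiv.sigmaEquivProd (S) (Fin N × Fin N))) T p s‖ * δ p s ≤ κ)
    (hErow : ∀ c p, |hf c p.1| * ∑ s, ‖LinearMap.toMatrix ((Pi.basis fun _ : S => Matrix.stdBasis ℂ (Fin N) (Fin N)).reindex (Equiv.sigmaEquivProd (S) (Fin N × Fin N)))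
        ((Pi.basis fun _ : S => Matrix.stdBasis ℂ (Fin N) (Fin N)).reindex (Equiv.sigmaEquivProd (S) (Fin N × Fin N))) (Tloc c) p s
        - LinearMap.toMatrix ((Pi.basis fun _ : S => Matrix.stdBasis ℂ (Fin N) (Fin N)).reindex (Equiv.sigmaEquivProd (S) (Fin N × Fin N)))
        ((Pi.basis fun _ : S => Matrix.stdBasis ℂ (Fin N) (Fin N)).reindex (Equiv.sigmaEquivProd (S) (Fin N × Fin N))) T p s‖ ≤ ε)
    (hEcol : ∀ c s, ∑ p, |hf c p.1| * ‖LinearMap.toMatrix ((Pi.basis fun _ : S => Matrix.stdBasis ℂ (Fin N) (Fin N)).reindex (Equiv.sigmaEquivProd (S) (Fin N × Fin N)))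
        ((Pi.basis fun _ : S => Matrix.stdBasis ℂ (Fin N) (Fin N)).reindex (Equiv.sigmaEquivProd (S) (Fin N × Fin N))) (Tloc c) p s
        - LinearMap.toMatrix ((Pi.basis fun _ : S => Matrix.stdBasis ℂ (Fin N) (Fin N)).reindex (Equiv.sigmaEquivProd (S) (Fin N × Fin N)))
        ((Pi.basis fun _ : S => Matrix.stdBasis ℂ (Fin N) (Fin N)).reindex (Equiv.sigmaEquivProd (S) (Fin N × Fin N))) T p s‖ ≤ ε)
    (A : S → Matrix (Fin N) (Fin N) ℂ) :
    trIP (fun _ => (1 : ℝ)) A ((∑ c, (cutMulY (hf c) * Tloc c - T * cutMulY (hf c)) * Gop c * cutMulY (hf c) :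
        Module.End ℂ (S → Matrix (Fin N) (Fin N) ℂ)) A) ≤ n * g * (2 * ω * κ + ε) * trIP (fun _ => (1 : ℝ)) A A := by
  rw [trIP_one_apply_eq_re_form_toMatrix, trIP_one_self_eq_sum_norm_sq, toMatrix_localRemainder]
  exact (le_abs_self _).trans (abs_re_form_localRemainder_le
    (LinearMap.toMatrix ((Pi.basis fun _ : S => Matrix.stdBasis ℂ (Fin N) (Fin N)).reindex (Equiv.sigmaEquivProd (S) (Fin N × Fin N)))
        ((Pi.basis fun _ : S => Matrix.stdBasis ℂ (Fin N) (Fin N)).reindex (Equiv.sigmaEquivProd (S) (Fin N × Fin N))) T)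
    (fun c => LinearMap.toMatrix ((Pi.basis fun _ : S => Matrix.stdBasis ℂ (Fin N) (Fin N)).reindex (Equiv.sigmaEquivProd (S) (Fin N × Fin N)))
        ((Pi.basis fun _ : S => Matrix.stdBasis ℂ (Fin N) (Fin N)).reindex (Equiv.sigmaEquivProd (S) (Fin N × Fin N))) (Tloc c))
    (fun c => LinearMap.toMatrix ((Pi.basis fun _ : S => Matrix.stdBasis ℂ (Fin N) (Fin N)).reindex (Equiv.sigmaEquivProd (S) (Fin N × Fin N)))
        ((Pi.basis fun _ : S => Matrix.stdBasis ℂ (Fin N) (Fin N)).reindex (Equiv.sigmaEquivProd (S) (Fin N × Fin N))) (Gop c))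
    (fun c s => hf c s.1) δ hω hδ hg hε (fun c s => hh1 c s.1) hlip (fun s => hov s.1) hGrow hGcol hTrow hTcol hErow hEcol _)

omit [Fintype S] [DecidableEq S] [DecidableEq ι] in
/-- a partition of unity `Σ_c h_c² = 1` has `|h_c| ≤ 1`. [cite: Balaban1985BackgroundPropagators, (3.87) p.409 («Σ h_□² = 1»), bookkeeping] -/
theorem abs_le_one_of_sum_sq_eq_one {X : Type} (hf : ι → X → ℝ) (hsq : ∀ z, ∑ c, hf c z ^ 2 = 1) (c : ι) (z : X) : |hf c z| ≤ 1 := by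
  have h1 : hf c z ^ 2 ≤ 1 := by
    rw [← hsq z]
    exact Finset.single_le_sum (f := fun c => hf c z ^ 2) (fun c _ => sq_nonneg _) (Finset.mem_univ c)
  exact (sq_le_one_iff_abs_le_one _).mp h1

end Operators

end Literature.MathematicalPhysics.QuantumFieldTheory.Balaban1983to89.B13LocalisationRemainderLetters

end
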